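import Mathlib
import HarnessLib
import Summits.ValiantsHypothesis.ValiantsHypothesis.Theses.MonotoneRestoration
import Literature.Computability.AlgebraicComplexity.ArithCircuit
import Literature.Computability.AlgebraicComplexity.ArithCircuitProofs
import Literature.Computability.AlgebraicComplexity.MonotoneStructure
import Literature.Computability.AlgebraicComplexity.PermanentIrreducible
import Literature.ModelTheory.FiniteModelTheory.CkEquiv
import Summits.ValiantsHypothesis.ValiantsHypothesis.Theorems.MonotoneRestorationMonotoneRestorationQPCosetCount
import Summits.ValiantsHypothesis.ValiantsHypothesis.Theorems.MonotoneRestorationMonotoneRestorationQPSymmetricLB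
import Summits.ValiantsHypothesis.ValiantsHypothesis.Theorems.MonotoneRestorationMonotoneRestorationQPSupportSymmetrisation
import Summits.ValiantsHypothesis.ValiantsHypothesis.Theorems.MonotoneRestorationMonotoneRestorationQPSparseRegime
import Summits.ValiantsHypothesis.ValiantsHypothesis.Theorems.MonotoneRestorationMonotoneRestorationQPBeta
import Literature.Computability.AlgebraicComplexity.SymmetricArithCircuit
import Literature.Computability.AlgebraicComplexity.DawarWilsenach2025Proofs
import Literature.GroupTheory.PermutationGroups.SmallIndexSubgroups
import Summits.ValiantsHypothesis.ValiantsHypothesis.Theorems.MonotoneRestorationQP.Negative.LoadBearing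
import Summits.ValiantsHypothesis.ValiantsHypothesis.Theorems.MonotoneRestorationMonotoneRestorationQPPermSupportCount

/-! TTRL-lite variant V19402 of stmt-ValiantsHypothesis-15886 -/

set_option linter.dupNamespace false

namespace Summit.ValiantsHypothesis.ValiantsHypothesis.Theorems

open Summit.ValiantsHypothesis.ValiantsHypothesis.Theses.MonotoneRestoration
open Literature.Computability.AlgebraicComplexity

/-- TTRL-lite variant V19402 (`lemma_proposal`) of `stub_gammaArithmetic`
(stmt-ValiantsHypothesis-15886): the block parameter `k(c,n) = (log₂ n + c)^c + 2` is at least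
`4` as soon as `c ≥ 1` and `n ≥ 2` — the side condition of the arithmetic reduction, so only
`c = 0` (`k = 3`) is degenerate.  Proof: `log₂ n ≥ 1` (`Nat.log_pos`), hence the base
`log₂ n + c ≥ 2`; and `b ^ c ≥ b ^ 1 = b` for `c ≥ 1` and `b ≥ 1` (`Nat.pow_le_pow_right`). -/
theorem stub_gammaArithmetic_var19402 :
    ∀ (n c : ℕ), 1 ≤ c → 2 ≤ n → 4 ≤ (Nat.log 2 n + c) ^ c + 2 := by
  intro n c hc hn
  have h1 : 1 ≤ Nat.log 2 n := Nat.log_pos (by norm_num) hn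
  have h2 : 2 ≤ Nat.log 2 n + c := by omega
  have h3 : (Nat.log 2 n + c) ^ 1 ≤ (Nat.log 2 n + c) ^ c :=
    Nat.pow_le_pow_right (by omega) hc
  rw [pow_one] at h3
  omega

end Summit.ValiantsHypothesis.ValiantsHypothesis.Theorems
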